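import Summits.KontsevichZagierPeriods.KontsevichZagierPeriods.Theorems.UnfoldedStokesStokesGenerationFibrewiseRungScalingSwaps
import Summits.KontsevichZagierPeriods.KontsevichZagierPeriods.Theorems.UnfoldedStokesStokesGenerationFibrewiseClosureCongr
import Summits.KontsevichZagierPeriods.KontsevichZagierPeriods.Theorems.UnfoldedStokesStokesGenerationFibrewiseClosureMulFresh

/-!
# `StokesGeneration` (stmt-KontsevichZagierPeriods-3586) — line `fibrewise_stokes`, stub `stub_logProductHomotopy`

Registered rung stub G2 (rung 19, the FIVE-TERM RELATION of the dilogarithm, wave 3) of the line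
`fibrewise_stokes` of the crux `StokesGeneration` (route UnfoldedStokes): the generic LOG-PRODUCT HOMOTOPY.
On the closed cube `[0,1]³` (`s = x 0`, `t = x 1`, `v = x 2`), for abstract one-dimensional parametric
integrands `ℓ(s,v)` with `v`-derivative `ℓᵥ(s,v)` admitting a closed-form `s`-primitive `μ` (`∂_s μ = ℓᵥ`,
`μ(0,v) = 0`), all `ℚ`-semialgebraic and continuous on the closed square, the function
`½(ℓ(s,v)ℓᵥ(t,v) − ℓᵥ(s,v)ℓ(t,v)) + μ(1,v)ℓ(t,v) − (½ℓ(s,1)ℓ(t,1) − ½ℓ(s,0)ℓ(t,0))`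
is fibrewise-Stokes decomposable (`FibStokesDecomposable 3`, `Theorems/UnfoldedStokesDefs.lean`).

Proof. Two fibrewise Stokes elements on the same cube, no kink sets, no transcendence input:
* along `v` (direction `2`) with primitive `G₀ = ½ ℓ(s,v) ℓ(t,v)`, fibre derivative
  `D₀ = ½(ℓᵥ(s,v)ℓ(t,v) + ℓ(s,v)ℓᵥ(t,v))` (product rule) and faces `½ℓ(s,1)ℓ(t,1) − ½ℓ(s,0)ℓ(t,0)`;
* along `s` (direction `0`) with primitive `G₁ = −μ(s,v) ℓ(t,v)`, fibre derivative `D₁ = −ℓᵥ(s,v)ℓ(t,v)`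
  and faces `−μ(1,v)ℓ(t,v) + μ(0,v)ℓ(t,v) = −μ(1,v)ℓ(t,v)`.
The two integrands `Dⱼ − (faces)` are carried by closed-cube representations (`exists_cubeRep`); the family is
decomposable (`fibStokesDecomposable_of_elements`), and its sum equals the displayed function at every point of
the cube, so `fibStokesDecomposable_congr_off_null` with the empty null set concludes. The two-variable data are
read on pairs of cube coordinates through `isSemialgebraicFunOn_comp_coord`.

References: D. Zagier, *The dilogarithm function* (2007), §I.2 (the five-term relation);
M. Kontsevich, D. Zagier, *Periods* (2001), §1.2 (rule (3), Newton–Leibniz/Stokes).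
-/

noncomputable section

-- `Summit.KontsevichZagierPeriods.KontsevichZagierPeriods.…` is the tree's mandated layout (single-conjunct summit).
set_option linter.dupNamespace false

namespace Summit.KontsevichZagierPeriods.KontsevichZagierPeriods.Cruxes.StokesGeneration.FibrewiseStokes

open MeasureTheory Set
open Literature.NumberTheory.Transcendental
open Literature.NumberTheory.Transcendental.KZ
open Literature.ModelTheory.ExponentialFields (IsSemialgebraic)

/-- Reading a two-variable function of the closed unit square on two coordinates `i, k` of the closed unit
cube preserves `ℚ`-semialgebraicity and continuity. [folklore] -/
private theorem logProductHomotopy_read {F : ℝ → ℝ → ℝ}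
    (hF : IsSemialgebraicFunOn ℚ (Set.pi Set.univ (fun _ : Fin 2 => Set.Icc (0:ℝ) 1)) (fun z => F (z 0) (z 1)))
    (hFc : ContinuousOn (fun z : Fin 2 → ℝ => F (z 0) (z 1)) (Set.pi Set.univ (fun _ : Fin 2 => Set.Icc (0:ℝ) 1)))
    (i k : Fin 3) :
    IsSemialgebraicFunOn ℚ (Set.pi Set.univ (fun _ : Fin 3 => Set.Icc (0:ℝ) 1)) (fun x => F (x i) (x k)) ∧
      ContinuousOn (fun x : Fin 3 → ℝ => F (x i) (x k)) (Set.pi Set.univ (fun _ : Fin 3 => Set.Icc (0:ℝ) 1)) := by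
  have hS : IsSemialgebraic ℚ (Set.pi Set.univ (fun _ : Fin 3 => Set.Icc (0:ℝ) 1)) := by
    rw [← cube_eq_pi]; exact isSemialgebraic_cube
  have hmaps : ∀ x ∈ Set.pi Set.univ (fun _ : Fin 3 => Set.Icc (0:ℝ) 1),
      (fun j => x ((![i, k] : Fin 2 → Fin 3) j)) ∈ Set.pi Set.univ (fun _ : Fin 2 => Set.Icc (0:ℝ) 1) :=
    fun x hx => Set.mem_univ_pi.mpr fun j => (Set.mem_univ_pi.mp hx) _
  refine ⟨?_, ?_⟩
  · exact (isSemialgebraicFunOn_comp_coord hF (![i, k] : Fin 2 → Fin 3)).mono (fun x hx => hmaps x hx) hS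
  · exact hFc.comp (continuous_pi fun j => continuous_apply ((![i, k] : Fin 2 → Fin 3) j)).continuousOn hmaps

/-- **Registered stub `stub_logProductHomotopy` (rung 19, G2): the generic log-product homotopy.** On `[0,1]³`
(`s = x 0`, `t = x 1`, `v = x 2`) the two elements `E_v[G = ½ℓ(s,v)ℓ(t,v)]`, `E_s[G = −μ(s,v)ℓ(t,v)]` certify
`½(ℓℓᵥ − ℓᵥℓ) + μ(1,v)ℓ(t,v) − (½ℓℓ|_{v=1} − ½ℓℓ|_{v=0}) ∈ Dec` for abstract `ℚ`-semialgebraic continuous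
`ℓ, ℓᵥ = ∂_vℓ, μ = ∫₀ˢ ℓᵥ` on the closed square. [cite: Zagier2007Dilogarithm, §I.2] -/
theorem stub_logProductHomotopy (ℓ ℓᵥ μ : ℝ → ℝ → ℝ)
    (hℓ : IsSemialgebraicFunOn ℚ (Set.pi Set.univ (fun _ : Fin 2 => Set.Icc (0:ℝ) 1)) (fun z => ℓ (z 0) (z 1)))
    (hℓᵥ : IsSemialgebraicFunOn ℚ (Set.pi Set.univ (fun _ : Fin 2 => Set.Icc (0:ℝ) 1)) (fun z => ℓᵥ (z 0) (z 1)))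
    (hμ : IsSemialgebraicFunOn ℚ (Set.pi Set.univ (fun _ : Fin 2 => Set.Icc (0:ℝ) 1)) (fun z => μ (z 0) (z 1)))
    (hℓc : ContinuousOn (fun z : Fin 2 → ℝ => ℓ (z 0) (z 1)) (Set.pi Set.univ (fun _ : Fin 2 => Set.Icc (0:ℝ) 1)))
    (hℓᵥc : ContinuousOn (fun z : Fin 2 → ℝ => ℓᵥ (z 0) (z 1)) (Set.pi Set.univ (fun _ : Fin 2 => Set.Icc (0:ℝ) 1)))
    (hμc : ContinuousOn (fun z : Fin 2 → ℝ => μ (z 0) (z 1)) (Set.pi Set.univ (fun _ : Fin 2 => Set.Icc (0:ℝ) 1)))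
    (hdv : ∀ s ∈ Set.Icc (0:ℝ) 1, ∀ v ∈ Set.Ioo (0:ℝ) 1, HasDerivAt (fun u => ℓ s u) (ℓᵥ s v) v)
    (hds : ∀ v ∈ Set.Icc (0:ℝ) 1, ∀ s ∈ Set.Ioo (0:ℝ) 1, HasDerivAt (fun u => μ u v) (ℓᵥ s v) s)
    (hμ0 : ∀ v ∈ Set.Icc (0:ℝ) 1, μ 0 v = 0) :
    FibStokesDecomposable 3 (fun x =>
      (1 / 2) * (ℓ (x 0) (x 2) * ℓᵥ (x 1) (x 2) - ℓᵥ (x 0) (x 2) * ℓ (x 1) (x 2)) + μ 1 (x 2) * ℓ (x 1) (x 2) -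
        ((1 / 2) * (ℓ (x 0) 1 * ℓ (x 1) 1) - (1 / 2) * (ℓ (x 0) 0 * ℓ (x 1) 0))) := by
  classical
  -- the two-variable data read on pairs of cube coordinates
  obtain ⟨hA0sa, hA0c⟩ := logProductHomotopy_read hℓ hℓc 0 2
  obtain ⟨hA1sa, hA1c⟩ := logProductHomotopy_read hℓ hℓc 1 2
  obtain ⟨hV0sa, hV0c⟩ := logProductHomotopy_read hℓᵥ hℓᵥc 0 2
  obtain ⟨hV1sa, hV1c⟩ := logProductHomotopy_read hℓᵥ hℓᵥc 1 2
  obtain ⟨hM0sa, hM0c⟩ := logProductHomotopy_read hμ hμc 0 2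
  set C : Set (Fin 3 → ℝ) := Set.pi Set.univ (fun _ : Fin 3 => Set.Icc (0:ℝ) 1) with hC
  have hCsa : IsSemialgebraic ℚ C := by rw [hC, ← cube_eq_pi]; exact isSemialgebraic_cube
  have hCc : IsCompact C := isCompact_univ_pi fun _ => isCompact_Icc
  have hmem : ∀ x ∈ C, ∀ i, x i ∈ Set.Icc (0:ℝ) 1 := fun x hx i => (Set.mem_univ_pi.mp hx) i
  have hupd : ∀ x ∈ C, ∀ (i : Fin 3), ∀ s ∈ Set.Icc (0:ℝ) 1, Function.update x i s ∈ C :=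
    fun x hx i s hs => update_mem_cubePi hx i hs
  have h02 : (0 : Fin 3) ≠ 2 := by decide
  have h12 : (1 : Fin 3) ≠ 2 := by decide
  have h10 : (1 : Fin 3) ≠ 0 := by decide
  have h20 : (2 : Fin 3) ≠ 0 := by decide
  have h0I : (0:ℝ) ∈ Set.Icc (0:ℝ) 1 := ⟨le_rfl, zero_le_one⟩
  have h1I : (1:ℝ) ∈ Set.Icc (0:ℝ) 1 := ⟨zero_le_one, le_rfl⟩
  have hhalf : IsSemialgebraicFunOn ℚ C (fun _ => (1 / 2 : ℝ)) :=
    (isSemialgebraicFunOn_const_of_isAlgebraic hCsa isAlgebraic_one).div (isSemialgebraicFunOn_const_ofNat hCsa 2)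
      fun _ _ => two_ne_zero
  -- the witnesses
  obtain ⟨G0, hG0⟩ : ∃ G0 : (Fin 3 → ℝ) → ℝ, G0 = fun x => 1 / 2 * (ℓ (x 0) (x 2) * ℓ (x 1) (x 2)) := ⟨_, rfl⟩
  obtain ⟨D0, hD0⟩ : ∃ D0 : (Fin 3 → ℝ) → ℝ,
      D0 = fun x => 1 / 2 * (ℓᵥ (x 0) (x 2) * ℓ (x 1) (x 2) + ℓ (x 0) (x 2) * ℓᵥ (x 1) (x 2)) := ⟨_, rfl⟩
  obtain ⟨G1, hG1⟩ : ∃ G1 : (Fin 3 → ℝ) → ℝ, G1 = fun x => -(μ (x 0) (x 2) * ℓ (x 1) (x 2)) := ⟨_, rfl⟩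
  obtain ⟨D1, hD1⟩ : ∃ D1 : (Fin 3 → ℝ) → ℝ, D1 = fun x => -(ℓᵥ (x 0) (x 2) * ℓ (x 1) (x 2)) := ⟨_, rfl⟩
  have hG0sa : IsSemialgebraicFunOn ℚ C G0 := by rw [hG0]; exact hhalf.fun_mul (hA0sa.fun_mul hA1sa)
  have hD0sa : IsSemialgebraicFunOn ℚ C D0 := by
    rw [hD0]; exact hhalf.fun_mul ((hV0sa.fun_mul hA1sa).fun_add (hA0sa.fun_mul hV1sa))
  have hG1sa : IsSemialgebraicFunOn ℚ C G1 := by rw [hG1]; exact (hM0sa.fun_mul hA1sa).fun_neg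
  have hD1sa : IsSemialgebraicFunOn ℚ C D1 := by rw [hD1]; exact (hV0sa.fun_mul hA1sa).fun_neg
  have hG0c : ContinuousOn G0 C := by rw [hG0]; exact continuousOn_const.mul (hA0c.mul hA1c)
  have hD0c : ContinuousOn D0 C := by
    rw [hD0]; exact continuousOn_const.mul ((hV0c.mul hA1c).add (hA0c.mul hV1c))
  have hG1c : ContinuousOn G1 C := by rw [hG1]; exact (hM0c.mul hA1c).neg
  have hD1c : ContinuousOn D1 C := by rw [hD1]; exact (hV0c.mul hA1c).neg
  -- composition with the (semialgebraic, continuous) face maps `x ↦ x[i ↦ t]`, `t ∈ {0, 1}`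
  have hface_sa : ∀ {F : (Fin 3 → ℝ) → ℝ}, IsSemialgebraicFunOn ℚ C F → ∀ (i : Fin 3) (t : ℝ), IsAlgebraic ℚ t →
      t ∈ Set.Icc (0:ℝ) 1 → IsSemialgebraicFunOn ℚ C (fun x => F (Function.update x i t)) :=
    fun hF i t ht htI => IsSemialgebraicFunOn.comp_isSemialgebraicMapOn_holds hF
      (isSemialgebraicMapOn_update_const i ht) fun x hx => hupd x hx i t htI
  have hface_c : ∀ {F : (Fin 3 → ℝ) → ℝ}, ContinuousOn F C → ∀ (i : Fin 3) (t : ℝ), t ∈ Set.Icc (0:ℝ) 1 →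
      ContinuousOn (fun x => F (Function.update x i t)) C :=
    fun hF i t htI => hF.comp (continuous_id.update i continuous_const).continuousOn fun x hx => hupd x hx i t htI
  have hcu : ∀ (x : Fin 3 → ℝ) (i : Fin 3), Continuous fun s : ℝ => Function.update x i s :=
    fun x i => continuous_const.update i continuous_id
  -- the two integrands and their representations on the cube
  obtain ⟨I0, hI0⟩ : ∃ I0 : (Fin 3 → ℝ) → ℝ, I0 = fun x =>
      D0 x - (G0 (Function.update x 2 1) - G0 (Function.update x 2 0)) := ⟨_, rfl⟩
  obtain ⟨I1, hI1⟩ : ∃ I1 : (Fin 3 → ℝ) → ℝ, I1 = fun x =>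
      D1 x - (G1 (Function.update x 0 1) - G1 (Function.update x 0 0)) := ⟨_, rfl⟩
  have hI0sa : IsSemialgebraicFunOn ℚ C I0 := by
    rw [hI0]
    exact hD0sa.fun_sub ((hface_sa hG0sa 2 1 isAlgebraic_one h1I).fun_sub (hface_sa hG0sa 2 0 isAlgebraic_zero h0I))
  have hI1sa : IsSemialgebraicFunOn ℚ C I1 := by
    rw [hI1]
    exact hD1sa.fun_sub ((hface_sa hG1sa 0 1 isAlgebraic_one h1I).fun_sub (hface_sa hG1sa 0 0 isAlgebraic_zero h0I))
  have hI0c : ContinuousOn I0 C := by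
    rw [hI0]; exact hD0c.sub ((hface_c hG0c 2 1 h1I).sub (hface_c hG0c 2 0 h0I))
  have hI1c : ContinuousOn I1 C := by
    rw [hI1]; exact hD1c.sub ((hface_c hG1c 0 1 h1I).sub (hface_c hG1c 0 0 h0I))
  obtain ⟨q0, hq0d, hq0i⟩ := exists_cubeRep 3 I0 hI0sa hI0c
  obtain ⟨q1, hq1d, hq1i⟩ := exists_cubeRep 3 I1 hI1sa hI1c
  -- bounds
  have hbound : ∀ {F : (Fin 3 → ℝ) → ℝ}, ContinuousOn F C → ∃ B : ℝ, ∀ x ∈ C, |F x| ≤ B := fun hF => by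
    obtain ⟨B, hB⟩ := hCc.exists_bound_of_continuousOn hF
    exact ⟨B, fun x hx => by simpa [Real.norm_eq_abs] using hB x hx⟩
  -- assemble the two elements
  have hdec : FibStokesDecomposable 3 (fun x => ∑ j, ((![q0, q1] : Fin 2 → IntegralRep 3) j).integrand x) := by
    refine fibStokesDecomposable_of_elements (M := 3) (J := 2) (![2, 0] : Fin 2 → Fin 3)
      (![G0, G1] : Fin 2 → (Fin 3 → ℝ) → ℝ) (![D0, D1] : Fin 2 → (Fin 3 → ℝ) → ℝ)
      (![q0, q1] : Fin 2 → IntegralRep 3) ?_ ?_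
    · refine Fin.forall_fin_two.mpr ⟨?_, ?_⟩
      · -- element 0, along `v = x 2`
        simp only [Matrix.cons_val_zero]
        refine ⟨hG0sa, hD0sa, hbound hG0c, fun x hx => ?_, fun x hx hx2' => ?_⟩
        · show ContinuousOn (fun s : ℝ => G0 (Function.update x 2 s)) (Set.Icc (0:ℝ) 1)
          exact hG0c.comp (hcu x 2).continuousOn fun s hs => hupd x hx 2 s hs
        · show HasDerivAt (fun s : ℝ => G0 (Function.update x 2 s)) (D0 x) (x 2)
          have hfun : (fun s : ℝ => G0 (Function.update x 2 s)) = fun s => 1 / 2 * (ℓ (x 0) s * ℓ (x 1) s) := by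
            funext s; rw [hG0]
            simp only [Function.update_self, Function.update_of_ne h02, Function.update_of_ne h12]
          rw [hfun, hD0]
          exact ((hdv (x 0) (hmem x hx 0) (x 2) hx2').mul (hdv (x 1) (hmem x hx 1) (x 2) hx2')).const_mul (1 / 2)
      · -- element 1, along `s = x 0`
        simp only [Matrix.cons_val_one, Matrix.cons_val_zero]
        refine ⟨hG1sa, hD1sa, hbound hG1c, fun x hx => ?_, fun x hx hx0' => ?_⟩
        · show ContinuousOn (fun s : ℝ => G1 (Function.update x 0 s)) (Set.Icc (0:ℝ) 1)
          exact hG1c.comp (hcu x 0).continuousOn fun s hs => hupd x hx 0 s hs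
        · show HasDerivAt (fun s : ℝ => G1 (Function.update x 0 s)) (D1 x) (x 0)
          have hfun : (fun s : ℝ => G1 (Function.update x 0 s)) = fun s => -(μ s (x 2) * ℓ (x 1) (x 2)) := by
            funext s; rw [hG1]
            simp only [Function.update_self, Function.update_of_ne h10, Function.update_of_ne h20]
          rw [hfun, hD1]
          exact ((hds (x 2) (hmem x hx 2) (x 0) hx0').mul_const (ℓ (x 1) (x 2))).neg
    · refine Fin.forall_fin_two.mpr ⟨?_, ?_⟩
      · simp only [Matrix.cons_val_zero]
        exact ⟨hq0d, fun x _ => by rw [hq0i, hI0]⟩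
      · simp only [Matrix.cons_val_one, Matrix.cons_val_zero]
        exact ⟨hq1d, fun x _ => by rw [hq1i, hI1]⟩
  -- the pointwise identity on the cube
  refine fibStokesDecomposable_congr_off_null 3 _ _ ∅
    Literature.ModelTheory.ExponentialFields.isSemialgebraic_empty measure_empty (fun x hx _ => ?_) hdec
  have hface0 : G0 (Function.update x 2 1) - G0 (Function.update x 2 0) =
      1 / 2 * (ℓ (x 0) 1 * ℓ (x 1) 1) - 1 / 2 * (ℓ (x 0) 0 * ℓ (x 1) 0) := by
    rw [hG0]
    simp only [Function.update_self, Function.update_of_ne h02, Function.update_of_ne h12]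
  have hface1 : G1 (Function.update x 0 1) - G1 (Function.update x 0 0) = -(μ 1 (x 2) * ℓ (x 1) (x 2)) := by
    rw [hG1]
    simp only [Function.update_self, Function.update_of_ne h10, Function.update_of_ne h20, hμ0 (x 2) (hmem x hx 2),
      zero_mul, neg_zero, sub_zero]
  simp only [Fin.sum_univ_two, Matrix.cons_val_zero, Matrix.cons_val_one, hq0i, hq1i, hI0, hI1, hface0, hface1,
    hD0, hD1]
  ring

end Summit.KontsevichZagierPeriods.KontsevichZagierPeriods.Cruxes.StokesGeneration.FibrewiseStokes

end
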